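import Summits.Ventures.LatticeQCDFlow.Exactness.NonreversibleDirichletComparison
import Summits.Ventures.LatticeQCDFlow.Exactness.ReversibleLazyChain
import HarnessLib

/-!
# The non-reversible comparison WITH A CONSTANT: `𝓔_S ≤ c·𝓔_K` for a reversible `S` (`c ≥ 1`) ⇒ `A_s(g; K) ≤ A_r(g; S)/(1 − s p)` with `p = 1 − 1/c`, hence `τ_int(g; K) + ½ ≤ c · (τ_int(g; S) + ½)`

HONEST FRAMING: exact (Metropolis-corrected) sampling algorithms for lattice gauge theory;
figures of merit are autocorrelation/cost numbers at stated couplings and volumes; no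
continuum-physics claim.

Venture `LatticeQCDFlow` (cell pub-lqcd), topic `Exactness`; FANOUT row 8 (`s0-cpn-nemc`, GEN-24).
NEW WORK of the cell in row 2's `RevOp` format, composing `Exactness/NonreversibleDirichletComparison`
(`K` any exact sampler, `S` reversible, `∫ v (K v) w ≤ ∫ v (S v) w` on the class ⇒
`A_r(g; K) ≤ A_r(g; S)`) with row 2's LAZY-CHAIN law `Exactness/ReversibleLazyChain`
(`L = (1 − p) S + p·1`: `𝓔_L = (1 − p) 𝓔_S`, `A^{(p)}_s = A_r/(1 − s p)` exactly, `r = s(1 − p)/(1 − s p)`).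
No re-derivation: if `S` moves at most `c` times as much as `K` (`𝓔_S(v) ≤ c 𝓔_K(v)`, `c ≥ 1`), then its
lazy version with holding probability `p = 1 − 1/c` moves at most as much as `K`, and the comparison
theorem applies to `(K, L)`.  Nothing is cited as a fact.  Printed counterparts NAMED ONLY:
Caracciolo–Pelissetto–Sokal 1990 / Andrieu–Lee–Vihola 2018 (the comparison with a constant for two
REVERSIBLE kernels — the tree's `Exactness/ReversibleComparison.abelSum_le_of_dirichlet_le_mul`); here
the better sampler `K` need not be reversible.

## What is proved (namespace `RevOp`; `C_K(k) = ∫ g (Kᵏ g) w`, `C_S` likewise; `𝓔_T(v) = ∫ v² w − ∫ v (T v) w`)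

* `quadForm_le_of_dirichlet_le_mul` — `𝓔_S ≤ c 𝓔_K`, `c ≥ 1`, `p = 1 − 1/c` ⇒
  `∫ v (K v) w ≤ ∫ v (L v) w` for the lazy `L = (1 − p) S + p·1`;
* **`abelSum_le_lazy_of_dirichlet_le_mul_nonrev`** — THE ABEL FORM (unconditional): for `g ∈ A`,
  `0 ≤ s < 1`: `Σ_k C_K(k) sᵏ ≤ (Σ_k C_S(k) rᵏ)/(1 − s p)`, `r = s(1 − p)/(1 − s p)`, `p = 1 − 1/c`;
* **`tsum_autocov_le_mul_nonrev`**, **`tauInt_add_half_le_mul_nonrev`** — under summability of both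
  normalised series (`∫ g² w > 0`): `Σ_k C_K(k) ≤ c · Σ_k C_S(k)` and
  **`τ_int(g; K) + ½ ≤ c · (τ_int(g; S) + ½)`** (`Scoring.tauInt`).

NOT CLAIMED: `c < 1` (an "anti-lazy" partner would be needed; the `c = 1` file already gives the weaker
factor `1`); any number of ours.
-/

namespace Summit.Ventures.LatticeQCDFlow.Exactness

open Real MeasureTheory Filter Finset Topology
open Summit.Ventures.LatticeQCDFlow.Scoring

namespace RevOp

variable {X : Type*} [MeasurableSpace X] {μ : Measure X} {w : X → ℝ} {A : (X → ℝ) → Prop}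
  {K S L : (X → ℝ) → (X → ℝ)}

/-- **The lazy partner is dominated**: if `𝓔_S(v) ≤ c · 𝓔_K(v)` on the class with `c ≥ 1`, then for
`p = 1 − 1/c` and `L v = (1 − p) S v + p v`: `∫ v (K v) w ≤ ∫ v (L v) w` on the class. -/
theorem quadForm_le_of_dirichlet_le_mul
    (hAi : ∀ ⦃f h : X → ℝ⦄, A f → A h → Integrable (fun x => f x * h x * w x) μ)
    (hAS : ∀ ⦃f : X → ℝ⦄, A f → A (S f)) {c : ℝ} (hc : 1 ≤ c)
    (hdom : ∀ ⦃v : X → ℝ⦄, A v →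
      (∫ x, v x ^ 2 * w x ∂μ) - ∫ x, v x * S v x * w x ∂μ
        ≤ c * ((∫ x, v x ^ 2 * w x ∂μ) - ∫ x, v x * K v x * w x ∂μ))
    (hL : ∀ f x, L f x = (1 - (1 - 1 / c)) * S f x + (1 - 1 / c) * f x)
    {v : X → ℝ} (hv : A v) :
    ∫ x, v x * K v x * w x ∂μ ≤ ∫ x, v x * L v x * w x ∂μ := by
  have hc0 : 0 < c := lt_of_lt_of_le one_pos hc
  have e : ∀ x, v x * L v x * w x = (1 / c) * (v x * S v x * w x) + (1 - 1 / c) * (v x ^ 2 * w x) := by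
    intro x; rw [hL]; ring
  simp_rw [e]
  rw [integral_add ((hAi hv (hAS hv)).const_mul _) ((integrable_sq_mul hAi hv).const_mul _),
    integral_const_mul, integral_const_mul]
  have h := hdom hv
  -- `∫ vKv ≤ (1/c)∫ vSv + (1 − 1/c)∫ v²`  ⟸  `∫v² − ∫vSv ≤ c(∫v² − ∫vKv)`
  have key : c * ∫ x, v x * K v x * w x ∂μ
      ≤ (∫ x, v x * S v x * w x ∂μ) + (c - 1) * ∫ x, v x ^ 2 * w x ∂μ := by linarith
  have hc' : c ≠ 0 := hc0.ne'
  have e1 : ∫ x, v x * K v x * w x ∂μ = (1 / c) * (c * ∫ x, v x * K v x * w x ∂μ) := by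
    field_simp
  rw [e1]
  calc (1 / c) * (c * ∫ x, v x * K v x * w x ∂μ)
      ≤ (1 / c) * ((∫ x, v x * S v x * w x ∂μ) + (c - 1) * ∫ x, v x ^ 2 * w x ∂μ) :=
        mul_le_mul_of_nonneg_left key (by positivity)
    _ = 1 / c * ∫ x, v x * S v x * w x ∂μ + (1 - 1 / c) * ∫ x, v x ^ 2 * w x ∂μ := by
        field_simp

/-- **THE SCALED COMPARISON, ABEL FORM (unconditional).**  `K` any exact sampler, `S` reversible, both
on the class, `𝓔_S ≤ c 𝓔_K` with `c ≥ 1`; `p = 1 − 1/c`.  For every `g ∈ A` and `0 ≤ s < 1`: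
`Σ_k C_K(k) sᵏ ≤ (Σ_k C_S(k) rᵏ)/(1 − s p)` with `r = s(1 − p)/(1 − s p)`. -/
theorem abelSum_le_lazy_of_dirichlet_le_mul_nonrev (hw0 : ∀ x, 0 ≤ w x)
    (hAi : ∀ ⦃f h : X → ℝ⦄, A f → A h → Integrable (fun x => f x * h x * w x) μ)
    (hAc : ∀ ⦃f h : X → ℝ⦄ (c : ℝ), A f → A h → A (fun x => f x + c * h x))
    (hAK : ∀ ⦃f : X → ℝ⦄, A f → A (K f))
    (hlin : ∀ ⦃f h : X → ℝ⦄ (c : ℝ), A f → A h →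
      ∀ x, K (fun s => f s + c * h s) x = K f x + c * K h x)
    (hcontr : ∀ ⦃f : X → ℝ⦄, A f → ∫ x, K f x ^ 2 * w x ∂μ ≤ ∫ x, f x ^ 2 * w x ∂μ)
    (hAS : ∀ ⦃f : X → ℝ⦄, A f → A (S f))
    (hlinS : ∀ ⦃f h : X → ℝ⦄ (c : ℝ), A f → A h →
      ∀ x, S (fun s => f s + c * h s) x = S f x + c * S h x)
    (hsymmS : ∀ ⦃f h : X → ℝ⦄, A f → A h →
      ∫ x, S f x * h x * w x ∂μ = ∫ x, f x * S h x * w x ∂μ)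
    (hcontrS : ∀ ⦃f : X → ℝ⦄, A f → ∫ x, S f x ^ 2 * w x ∂μ ≤ ∫ x, f x ^ 2 * w x ∂μ)
    {c : ℝ} (hc : 1 ≤ c)
    (hdom : ∀ ⦃v : X → ℝ⦄, A v →
      (∫ x, v x ^ 2 * w x ∂μ) - ∫ x, v x * S v x * w x ∂μ
        ≤ c * ((∫ x, v x ^ 2 * w x ∂μ) - ∫ x, v x * K v x * w x ∂μ))
    {g : X → ℝ} (hg : A g) {s : ℝ} (hs0 : 0 ≤ s) (hs1 : s < 1) :
    ∑' k, (∫ x, g x * (K^[k] g) x * w x ∂μ) * s ^ k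
      ≤ (∑' k, (∫ x, g x * (S^[k] g) x * w x ∂μ)
          * (s * (1 - (1 - 1 / c)) / (1 - s * (1 - 1 / c))) ^ k) / (1 - s * (1 - 1 / c)) := by
  set p : ℝ := 1 - 1 / c with hp
  have hc0 : 0 < c := lt_of_lt_of_le one_pos hc
  have hp0 : 0 ≤ p := by
    rw [hp, sub_nonneg, div_le_one hc0]; exact hc
  have hp1 : p < 1 := by
    rw [hp]; have : 0 < 1 / c := by positivity
    linarith
  -- the lazy partner `L = (1 − p) S + p·1`
  set L : (X → ℝ) → (X → ℝ) := fun f x => (1 - p) * S f x + p * f x with hLdef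
  have hL : ∀ f x, L f x = (1 - p) * S f x + p * f x := fun f x => rfl
  have hAL : ∀ ⦃f : X → ℝ⦄, A f → A (L f) := fun f hf => lazy_mem hAc hAS hL hf
  have hlinL : ∀ ⦃f h : X → ℝ⦄ (c : ℝ), A f → A h → ∀ x,
      L (fun s => f s + c * h s) x = L f x + c * L h x :=
    fun f h c hf hh x => lazy_add_mul hlinS hL c hf hh x
  have hsymmL : ∀ ⦃f h : X → ℝ⦄, A f → A h →
      ∫ x, L f x * h x * w x ∂μ = ∫ x, f x * L h x * w x ∂μ :=
    fun f h hf hh => lazy_symm hAi hAS hsymmS hL hf hh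
  have hcontrL : ∀ ⦃f : X → ℝ⦄, A f → ∫ x, L f x ^ 2 * w x ∂μ ≤ ∫ x, f x ^ 2 * w x ∂μ :=
    fun f hf => lazy_contr hw0 hAi hAc hAS hcontrS hL hp0 hp1.le hf
  have hdomL : ∀ ⦃v : X → ℝ⦄, A v → ∫ x, v x * K v x * w x ∂μ ≤ ∫ x, v x * L v x * w x ∂μ :=
    fun v hv => quadForm_le_of_dirichlet_le_mul hAi hAS hc hdom hL hv
  have h1 := abelSum_le_of_quadForm_le_nonrev hw0 hAi hAc hAK hlin hcontr hAL hlinL hsymmL hcontrL hdomL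
    hg hs0 hs1
  have h2 := abelSum_lazy_eq hw0 hAi hAc hAS hlinS hsymmS hcontrS hL hp0 hp1 hg hs0 hs1
  rw [h2] at h1
  exact h1

/-! ## At `s = 1` under summability -/

/-- **`Σ_k C_K(k) ≤ c · Σ_k C_S(k)`** (`K` any exact sampler, `S` reversible, `𝓔_S ≤ c 𝓔_K`, `c ≥ 1`),
when `∫ g² w > 0` and both normalised autocorrelation series are summable. -/
theorem tsum_autocov_le_mul_nonrev (hw0 : ∀ x, 0 ≤ w x)
    (hAi : ∀ ⦃f h : X → ℝ⦄, A f → A h → Integrable (fun x => f x * h x * w x) μ)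
    (hAc : ∀ ⦃f h : X → ℝ⦄ (c : ℝ), A f → A h → A (fun x => f x + c * h x))
    (hAK : ∀ ⦃f : X → ℝ⦄, A f → A (K f))
    (hlin : ∀ ⦃f h : X → ℝ⦄ (c : ℝ), A f → A h →
      ∀ x, K (fun s => f s + c * h s) x = K f x + c * K h x)
    (hcontr : ∀ ⦃f : X → ℝ⦄, A f → ∫ x, K f x ^ 2 * w x ∂μ ≤ ∫ x, f x ^ 2 * w x ∂μ)
    (hAS : ∀ ⦃f : X → ℝ⦄, A f → A (S f))
    (hlinS : ∀ ⦃f h : X → ℝ⦄ (c : ℝ), A f → A h →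
      ∀ x, S (fun s => f s + c * h s) x = S f x + c * S h x)
    (hsymmS : ∀ ⦃f h : X → ℝ⦄, A f → A h →
      ∫ x, S f x * h x * w x ∂μ = ∫ x, f x * S h x * w x ∂μ)
    (hcontrS : ∀ ⦃f : X → ℝ⦄, A f → ∫ x, S f x ^ 2 * w x ∂μ ≤ ∫ x, f x ^ 2 * w x ∂μ)
    {c : ℝ} (hc : 1 ≤ c)
    (hdom : ∀ ⦃v : X → ℝ⦄, A v →
      (∫ x, v x ^ 2 * w x ∂μ) - ∫ x, v x * S v x * w x ∂μ
        ≤ c * ((∫ x, v x ^ 2 * w x ∂μ) - ∫ x, v x * K v x * w x ∂μ))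
    {g : X → ℝ} (hg : A g) (hP : 0 < ∫ x, g x ^ 2 * w x ∂μ)
    (hsK : Summable fun n => (∫ x, g x * (K^[n + 1] g) x * w x ∂μ) / ∫ x, g x ^ 2 * w x ∂μ)
    (hsS : Summable fun n => (∫ x, g x * (S^[n + 1] g) x * w x ∂μ) / ∫ x, g x ^ 2 * w x ∂μ) :
    ∑' k, ∫ x, g x * (K^[k] g) x * w x ∂μ ≤ c * ∑' k, ∫ x, g x * (S^[k] g) x * w x ∂μ := by
  set CK : ℕ → ℝ := fun k => ∫ x, g x * (K^[k] g) x * w x ∂μ with hCK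
  set CS : ℕ → ℝ := fun k => ∫ x, g x * (S^[k] g) x * w x ∂μ with hCS
  set P := ∫ x, g x ^ 2 * w x ∂μ with hPdef
  set p : ℝ := 1 - 1 / c with hp
  have hc0 : 0 < c := lt_of_lt_of_le one_pos hc
  have hp0 : 0 ≤ p := by
    rw [hp, sub_nonneg, div_le_one hc0]; exact hc
  have hp1 : p < 1 := by
    rw [hp]; have : 0 < 1 / c := by positivity
    linarith
  have hsρK : Summable fun k => CK k / P := (summable_nat_add_iff 1).1 hsK
  have hsCK : Summable CK := (hsρK.mul_left P).congr fun k => by field_simp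
  have hsρS : Summable fun k => CS k / P := (summable_nat_add_iff 1).1 hsS
  have hsCS : Summable CS := (hsρS.mul_left P).congr fun k => by field_simp
  -- the two Abel limits
  have habelK : Tendsto (fun x : ℝ => ∑' k, CK k * x ^ k) (𝓝[<] 1) (𝓝 (∑' k, CK k)) :=
    Real.tendsto_tsum_powerSeries_nhdsWithin_lt hsCK.hasSum.tendsto_sum_nat
  have habelS : Tendsto (fun x : ℝ => ∑' k, CS k * x ^ k) (𝓝[<] 1) (𝓝 (∑' k, CS k)) :=
    Real.tendsto_tsum_powerSeries_nhdsWithin_lt hsCS.hasSum.tendsto_sum_nat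
  -- the reparametrisation `r(s) = s(1 − p)/(1 − s p) → 1⁻`
  set ρ : ℝ → ℝ := fun x => x * (1 - p) / (1 - x * p) with hρ
  have hden : ∀ x : ℝ, x < 1 → 0 < 1 - x * p := by
    intro x hx
    have : x * p ≤ 1 * p := mul_le_mul_of_nonneg_right hx.le hp0
    linarith
  have hρcont : Tendsto ρ (𝓝[<] 1) (𝓝 1) := by
    have hne : (1 : ℝ) - 1 * p ≠ 0 := by rw [one_mul]; linarith
    have hc1 : ContinuousAt ρ 1 := ContinuousAt.div (by fun_prop) (by fun_prop) hne
    have := hc1.tendsto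
    have e : ρ 1 = 1 := by
      show 1 * (1 - p) / (1 - 1 * p) = 1
      rw [one_mul, one_mul]
      exact div_self (by linarith)
    rw [e] at this
    exact this.mono_left nhdsWithin_le_nhds
  have hρlt : ∀ᶠ x in 𝓝[<] (1 : ℝ), ρ x < 1 := by
    filter_upwards [self_mem_nhdsWithin] with x hx
    show x * (1 - p) / (1 - x * p) < 1
    rw [div_lt_one (hden x hx)]
    have : x * (1 - p) = x - x * p := by ring
    rw [this]
    linarith [Set.mem_Iio.mp hx]
  have hρwithin : Tendsto ρ (𝓝[<] 1) (𝓝[<] 1) :=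
    tendsto_nhdsWithin_of_tendsto_nhds_of_eventually_within ρ hρcont hρlt
  have habelSρ : Tendsto (fun x : ℝ => ∑' k, CS k * (ρ x) ^ k) (𝓝[<] 1) (𝓝 (∑' k, CS k)) :=
    habelS.comp hρwithin
  have hfac : Tendsto (fun x : ℝ => 1 - x * p) (𝓝[<] 1) (𝓝 (1 - p)) := by
    have : Continuous fun x : ℝ => 1 - x * p := continuous_const.sub (continuous_id.mul continuous_const)
    have h := this.tendsto 1
    rw [one_mul] at h
    exact h.mono_left nhdsWithin_le_nhds
  have hR : Tendsto (fun x : ℝ => (∑' k, CS k * (ρ x) ^ k) / (1 - x * p)) (𝓝[<] 1)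
      (𝓝 ((∑' k, CS k) / (1 - p))) := habelSρ.div hfac (by linarith)
  have hev : ∀ᶠ x in 𝓝[<] (1 : ℝ), ∑' k, CK k * x ^ k ≤ (∑' k, CS k * (ρ x) ^ k) / (1 - x * p) := by
    filter_upwards [Ioo_mem_nhdsLT (show (0 : ℝ) < 1 by norm_num)] with x hx
    exact abelSum_le_lazy_of_dirichlet_le_mul_nonrev hw0 hAi hAc hAK hlin hcontr hAS hlinS hsymmS hcontrS
      hc hdom hg hx.1.le hx.2
  have hlim := le_of_tendsto_of_tendsto habelK hR hev
  have e : (∑' k, CS k) / (1 - p) = c * ∑' k, CS k := by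
    rw [hp]
    have : c ≠ 0 := hc0.ne'
    field_simp
    ring
  rwa [e] at hlim

/-- **`τ_int(g; K) + ½ ≤ c · (τ_int(g; S) + ½)`** — the comparison theorem with a constant when the
BETTER sampler `K` is not reversible (`S` reversible, `𝓔_S ≤ c 𝓔_K`, `c ≥ 1`; `∫ g² w > 0`, both
normalised autocorrelation series summable; `Scoring.tauInt`). -/
theorem tauInt_add_half_le_mul_nonrev (hw0 : ∀ x, 0 ≤ w x)
    (hAi : ∀ ⦃f h : X → ℝ⦄, A f → A h → Integrable (fun x => f x * h x * w x) μ)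
    (hAc : ∀ ⦃f h : X → ℝ⦄ (c : ℝ), A f → A h → A (fun x => f x + c * h x))
    (hAK : ∀ ⦃f : X → ℝ⦄, A f → A (K f))
    (hlin : ∀ ⦃f h : X → ℝ⦄ (c : ℝ), A f → A h →
      ∀ x, K (fun s => f s + c * h s) x = K f x + c * K h x)
    (hcontr : ∀ ⦃f : X → ℝ⦄, A f → ∫ x, K f x ^ 2 * w x ∂μ ≤ ∫ x, f x ^ 2 * w x ∂μ)
    (hAS : ∀ ⦃f : X → ℝ⦄, A f → A (S f))
    (hlinS : ∀ ⦃f h : X → ℝ⦄ (c : ℝ), A f → A h →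
      ∀ x, S (fun s => f s + c * h s) x = S f x + c * S h x)
    (hsymmS : ∀ ⦃f h : X → ℝ⦄, A f → A h →
      ∫ x, S f x * h x * w x ∂μ = ∫ x, f x * S h x * w x ∂μ)
    (hcontrS : ∀ ⦃f : X → ℝ⦄, A f → ∫ x, S f x ^ 2 * w x ∂μ ≤ ∫ x, f x ^ 2 * w x ∂μ)
    {c : ℝ} (hc : 1 ≤ c)
    (hdom : ∀ ⦃v : X → ℝ⦄, A v →
      (∫ x, v x ^ 2 * w x ∂μ) - ∫ x, v x * S v x * w x ∂μ
        ≤ c * ((∫ x, v x ^ 2 * w x ∂μ) - ∫ x, v x * K v x * w x ∂μ))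
    {g : X → ℝ} (hg : A g) (hP : 0 < ∫ x, g x ^ 2 * w x ∂μ)
    (hsK : Summable fun n => (∫ x, g x * (K^[n + 1] g) x * w x ∂μ) / ∫ x, g x ^ 2 * w x ∂μ)
    (hsS : Summable fun n => (∫ x, g x * (S^[n + 1] g) x * w x ∂μ) / ∫ x, g x ^ 2 * w x ∂μ) :
    tauInt (fun n => (∫ x, g x * (K^[n] g) x * w x ∂μ) / ∫ x, g x ^ 2 * w x ∂μ) + 1 / 2
      ≤ c * (tauInt (fun n => (∫ x, g x * (S^[n] g) x * w x ∂μ) / ∫ x, g x ^ 2 * w x ∂μ) + 1 / 2) := by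
  set CK : ℕ → ℝ := fun k => ∫ x, g x * (K^[k] g) x * w x ∂μ with hCK
  set CS : ℕ → ℝ := fun k => ∫ x, g x * (S^[k] g) x * w x ∂μ with hCS
  set P := ∫ x, g x ^ 2 * w x ∂μ with hPdef
  have hmain := tsum_autocov_le_mul_nonrev hw0 hAi hAc hAK hlin hcontr hAS hlinS hsymmS hcontrS hc hdom
    hg hP hsK hsS
  have hsρK : Summable fun k => CK k / P := (summable_nat_add_iff 1).1 hsK
  have hsρS : Summable fun k => CS k / P := (summable_nat_add_iff 1).1 hsS
  have hCK0 : CK 0 = P := by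
    simp only [hCK, hPdef, Function.iterate_zero, id_eq]
    exact integral_congr_ae (Eventually.of_forall fun x => by ring)
  have hCS0 : CS 0 = P := by
    simp only [hCS, hPdef, Function.iterate_zero, id_eq]
    exact integral_congr_ae (Eventually.of_forall fun x => by ring)
  have hK : ∑' k, CK k / P = tauInt (fun n => CK n / P) + 1 / 2 := by
    rw [hsρK.tsum_eq_zero_add, hCK0, div_self hP.ne']
    simp only [tauInt]
    ring
  have hS' : ∑' k, CS k / P = tauInt (fun n => CS n / P) + 1 / 2 := by
    rw [hsρS.tsum_eq_zero_add, hCS0, div_self hP.ne']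
    simp only [tauInt]
    ring
  have hdivK : (∑' k, CK k / P) = (∑' k, CK k) / P := tsum_div_const
  have hdivS : (∑' k, CS k / P) = (∑' k, CS k) / P := tsum_div_const
  have h : (∑' k, CK k) / P ≤ c * ((∑' k, CS k) / P) := by
    rw [← mul_div_assoc]
    exact div_le_div_of_nonneg_right hmain hP.le
  rw [← hdivK, ← hdivS, hK, hS'] at h
  exact h

end RevOp

end Summit.Ventures.LatticeQCDFlow.Exactness
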